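import Literature.NumberTheory.Sieve.BetaSieveSmallDimension
import HarnessLib

/-!
# The `β`-sieve in dimensions `κ > 1`: the least-`β` pin is never Iwaniec's

Trunk `AntSieve` (topic `NumberTheory/Sieve`); companion to `SieveFunctions.lean`,
`SieveFunctionsProofs.lean` and `BetaSieveSmallDimension.lean` (item
`provefact Literature.SieveSequence.jurkat_richert_upper`, verdict MISSTATED: the least-`β` pin
`IsBetaSieveData` behind `upperSieveFun`, `lowerSieveFun`, `siftingLimit` is not Iwaniec's
definition of `β_κ`, which is `1 +` the GREATEST zero of the adjoint `q_κ`, i.e. the greatest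
admissible parameter, `IsGreatestBetaSieveData`).

`BetaSieveSmallDimension.lean` shows that the two pins coincide for `1/2 ≤ κ ≤ 1`; the erratum of
`SieveFunctions.lean` records that they differ for `κ = 3/2`
(`SieveFunctionsProofs.siftingLimit_three_halves_lt`) and `κ = 2` (`JurkatRichertRefutation.lean`).
This file closes the gap: **for every `κ > 1` the pins differ**
(`siftingLimit_lt_iwaniecSiftingLimit`), so that `siftingLimit κ = iwaniecSiftingLimit κ ↔ κ ≤ 1`
on `κ ≥ 1/2` (`siftingLimit_eq_iwaniecSiftingLimit_iff`). Everything is proved (standard axioms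
only); the statements about the zeros of `q_κ` for general `κ > 1` are not printed in the sources
(Greaves, Lemma 4.2.3, gives "fewer than `2κ`" zeros and the existence of one) and are obtained
here from Greaves's own induction step.

## Results

* `SieveAdjoint.exists_zero_gt_of_adjoint_step`: Greaves's induction step (proof of
  Lemma 4.2.3 (ii)) with a threshold — along the ladder `r'_{a,b} = c r_{a−1,b}` a zero of the
  lower rung beyond `c` produces a zero of the upper rung beyond `c` (at the greatest zero `α` of
  the lower rung, `(a + b − 1) r_{a,b}(α) < 0`).
* `SieveAdjoint.exists_one_lt_zero_rLadder_two`, `SieveAdjoint.exists_one_lt_zero_rLadder`: for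
  `b > 1` every rung of the ladder `rLadder b x₀ n` of `SieveFunctionsAdjoint` with `n ≥ 2` vanishes
  somewhere in `(1, ∞)`. The start at `n = 2` is the dichotomy: for `x₀ = 0` the rung is `s − b`;
  for `x₀ > 0` the first rung `R₁` is strictly increasing (`R₁' = x₀ rBase > 0`), so either
  `R₁(1) < 0` (then `R₁` vanishes beyond `1` and the step applies) or `R₁(1) ≥ 0`, in which case
  `R₂(1) = R₁(1) − b ∫_1^2 R₁ < (1 − b) R₁(1) ≤ 0` and `R₂`, eventually positive, vanishes beyond `1`.
* `SieveAdjoint.exists_one_lt_zero_qFun`: hence for `κ > 1` the adjoint `q_κ = rLadder κ x₀ ⌊2κ⌋`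
  (`⌊2κ⌋ ≥ 2`) has a zero `> 1`, and `two_lt_iwaniecSiftingLimit`: **`β_κ > 2` for `κ > 1`**
  (`β_1 = 2`, `LinearSieveExistence.iwaniecSiftingLimit_one`).
* `SieveAdjoint.exists_neg_of_adjoint_of_pos`: for `κ > 1` a solution `g` of
  `(s g)' = κ g(s) + κ g(s+1)` with `g(1) > 0` is negative somewhere in `(0, 1)`:
  `G(s) = s^{1−κ} g(s)` has `G' = κ s^{−κ} g(s+1) ≥ κ m s^{−κ}` near `0⁺` and `∫_0 s^{−κ} = ∞`.
  Applied to `± q_κ`: `exists_qFun_neg_of_pos`, `exists_qFun_pos_of_neg`.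
* `SieveAdjoint.exists_two_zeros_qFun`: **for `κ > 1`, `q_κ` has (at least) two positive zeros**
  (trichotomy on `q_κ(1)` combined with the zero beyond `1`).
* `isLeast_siftingLimit_sub_one`, `isGreatest_iwaniecSiftingLimit_sub_one` (`κ > 1/2`):
  `siftingLimit κ − 1` is the LEAST and `iwaniecSiftingLimit κ − 1` the GREATEST positive zero of
  `q_κ` — the latter is Iwaniec's definition (Iwaniec 1980, §7; Greaves (4.2.4.10)).
* `siftingLimit_lt_iwaniecSiftingLimit` (`κ > 1`), `siftingLimit_eq_iwaniecSiftingLimit_iff`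
  (`κ ≥ 1/2`: `↔ κ ≤ 1`), `betaSieveData_ne_greatestBetaSieveData`,
  `isBetaSieveData_ne_isGreatestBetaSieveData`, `betaSieveConst_lt_iwaniecSieveConst`
  (`A`-constants, via Greaves Lemma 4.2.5: `A = 2(β − 1)^{κ−1}/p_κ(β − 1)` increases with `β`),
  `upperSieveFun_one_lt_iwaniecUpperSieveFun_one`, `upperSieveFun_ne_iwaniecUpperSieveFun`,
  `lowerSieveFun_ne_iwaniecLowerSieveFun` (`κ > 1`): none of the four least-`β` objects of
  `SieveFunctions.lean` is Iwaniec's for any `κ > 1`.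
* `IsBetaSieveSolution.lower_pos`: the lower function of a normalised solution is positive on
  `(β, β + 1)` (`κ > 0`).

## References

* [Greaves2001] G. Greaves, *Sieves in Number Theory*, Springer (2001), §4.2.3 (Lemma 4.2.3 and
  its proof, (4.2.3.18), (4.2.3.19)), §4.2.4 ((4.2.4.10)), Lemma 4.2.5.
* [IwaniecActaArith1980] H. Iwaniec, *Rosser's sieve*, Acta Arith. 36 (1980), 171–202, §§5–7.
* [DiamondHalberstamGalway2008] H. G. Diamond, H. Halberstam, W. F. Galway, *A Higher-Dimensional
  Sieve Method*, Cambridge (2008), Tables 15.2–15.3 (`ρ_κ`, `β_κ = ρ_κ + 1`).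
-/

open Filter Asymptotics Set MeasureTheory intervalIntegral Topology Real

noncomputable section

namespace Literature.NumberTheory.Sieve

open SieveAdjoint BetaSieveForward

namespace SieveAdjoint

variable {κ : ℝ}

/-! ### Greaves's induction step with a threshold -/

/-- **Greaves's induction step, with a threshold** (proof of Lemma 4.2.3 (ii)): let `g' = k h`
(`k > 0`) on `(0, ∞)`, let `g` solve `(s g)' = a g(s) + b g(s+1)` with `b > 0`, `a + b > 1`, let
`h` be continuous with finitely many positive zeros, and let both be eventually positive. If `h`
has a zero exceeding `c ≥ 0`, then so has `g`: for the greatest zero `α > c` of `h` one has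
`(a + b − 1) g(α) < 0`, and `g` vanishes somewhere beyond `α`. (The tree's
`exists_zero_of_adjoint_step` is the case without threshold.) [cite: Greaves2001, Lemma 4.2.3] -/
theorem exists_zero_gt_of_adjoint_step {g h : ℝ → ℝ} {k a b c : ℝ} (hk : 0 < k) (hb : 0 < b)
    (hab : 1 < a + b) (hd : ∀ s, 0 < s → HasDerivAt g (k * h s) s)
    (hadj : ∀ s, 0 < s → HasDerivAt (fun t => t * g t) (a * g s + b * g (s + 1)) s)
    (hh : ContinuousOn h (Ioi 0)) (hZ : {s | 0 < s ∧ h s = 0}.Finite) (hc : 0 ≤ c)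
    (hZc : ∃ z, c < z ∧ h z = 0) (hhpos : ∀ᶠ s in atTop, 0 < h s)
    (hgpos : ∀ᶠ s in atTop, 0 < g s) : ∃ z, c < z ∧ g z = 0 := by
  obtain ⟨z₀, hz₀c, hz₀⟩ := hZc
  have hz₀pos : 0 < z₀ := lt_of_le_of_lt hc hz₀c
  have hne : hZ.toFinset.Nonempty := ⟨z₀, by simpa using And.intro hz₀pos hz₀⟩
  set α := hZ.toFinset.max' hne with hα
  have hαmem : 0 < α ∧ h α = 0 := by
    have := hZ.toFinset.max'_mem hne
    simpa using this
  have hmax : ∀ z, 0 < z → h z = 0 → z ≤ α := fun z hz hz0 =>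
    hZ.toFinset.le_max' z (by simpa using And.intro hz hz0)
  have hcα : c < α := lt_of_lt_of_le hz₀c (hmax z₀ hz₀pos hz₀)
  -- `h > 0` on `(α, ∞)`
  have hpos : ∀ s, α < s → 0 < h s := by
    intro s hs
    by_contra hle
    push Not at hle
    obtain ⟨T, hT⟩ := Filter.eventually_atTop.mp hhpos
    set T' := max T s
    have hsT' : s ≤ T' := le_max_right _ _
    have hcs : ContinuousOn h (Icc s T') :=
      hh.mono fun x hx => lt_of_lt_of_le (hαmem.1.trans hs) hx.1
    obtain ⟨z, hz, hz0⟩ := intermediate_value_Icc hsT' hcs ⟨hle, (hT T' (le_max_left _ _)).le⟩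
    have := hmax z ((hαmem.1.trans hs).trans_le hz.1) hz0
    linarith [hz.1]
  -- `g` is strictly increasing on `[α, ∞)`
  have hgc : ContinuousOn g (Ici α) := continuousOn_of_forall_continuousAt fun x hx =>
    (hd x (lt_of_lt_of_le hαmem.1 hx)).continuousAt
  have hmono : StrictMonoOn g (Ici α) := by
    refine strictMonoOn_of_deriv_pos (convex_Ici α) hgc fun x hx => ?_
    rw [interior_Ici] at hx
    rw [(hd x (hαmem.1.trans hx)).deriv]
    exact mul_pos hk (hpos x hx)
  have hlt : g α < g (α + 1) := hmono self_mem_Ici (by simp) (by linarith)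
  -- the adjoint equation at `α`
  have h1 : HasDerivAt (fun t => t * g t) (1 * g α + α * (k * h α)) α :=
    (hasDerivAt_id α).mul (hd α hαmem.1)
  have heq := h1.unique (hadj α hαmem.1)
  rw [hαmem.2, mul_zero, mul_zero, add_zero, one_mul] at heq
  have hgα : g α < 0 := by nlinarith
  obtain ⟨z, hz, hz0⟩ := exists_zero_of_neg_of_eventually_pos
    (continuousOn_of_forall_continuousAt fun x hx => (hd x hx).continuousAt) hαmem.1 hgα hgpos
  exact ⟨z, hcα.trans hz, hz0⟩

/-! ### The rungs above level `2` vanish somewhere beyond `s = 1` (for `b > 1`) -/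

/-- The first rung is strictly increasing on `(0, ∞)` when `x₀ > 0`: its derivative is
`x₀ · rBase b x₀ > 0`. [folklore] -/
theorem strictMonoOn_rLadder_one (b : ℝ) {x₀ : ℝ} (hx0 : 0 < x₀) (hx : x₀ < 1) :
    StrictMonoOn (rLadder b x₀ 1) (Ioi 0) := by
  refine strictMonoOn_of_deriv_pos (convex_Ioi 0) (continuousOn_rLadder b hx 1) fun s hs => ?_
  rw [interior_Ioi] at hs
  rw [(hasDerivAt_rLadder_succ b hx 0 hs).deriv]
  simp only [Nat.cast_zero, add_zero, rLadder_zero]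
  exact mul_pos hx0 (rBase_pos b hx hs)

/-- **The second rung vanishes beyond `1` when `b > 1`.** For `x₀ = 0` it is `s − b`
(`rLadder_zero_two`). For `0 < x₀ < 1`: if `rLadder b x₀ 1 1 ≥ 0` then, the first rung being
strictly increasing, `rLadder b x₀ 2 1 = rLadder b x₀ 1 1 − b ∫_1^2 rLadder b x₀ 1 < (1 − b) rLadder b x₀ 1 1 ≤ 0`
and the rung, eventually positive, vanishes in `(1, ∞)`; if `rLadder b x₀ 1 1 < 0` then the first
rung vanishes beyond `1` and Greaves's step (`exists_zero_gt_of_adjoint_step`) lifts this zero.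
[folklore] -/
theorem exists_one_lt_zero_rLadder_two (b : ℝ) {x₀ : ℝ} (hx0 : 0 ≤ x₀) (hx : x₀ < 1)
    (hb : 1 < b) : ∃ z, 1 < z ∧ rLadder b x₀ 2 z = 0 := by
  rcases hx0.eq_or_lt with h0 | h0
  · subst h0
    exact ⟨b, hb, by rw [rLadder_zero_two]; ring⟩
  · have hcont1 := continuousOn_rLadder b hx 1
    have hcont2 := continuousOn_rLadder b hx 2
    have hpos1 := eventually_rLadder_pos b hx0 hx 1
    have hpos2 := eventually_rLadder_pos b hx0 hx 2
    by_cases hv : 0 ≤ rLadder b x₀ 1 1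
    · -- `R₂(1) < 0`
      have hmono := strictMonoOn_rLadder_one b h0 hx
      have hI : (∫ _t in (1 : ℝ)..2, rLadder b x₀ 1 1) < ∫ t in (1 : ℝ)..2, rLadder b x₀ 1 t := by
        refine intervalIntegral.integral_lt_integral_of_continuousOn_of_le_of_exists_lt one_lt_two
          continuousOn_const (hcont1.mono fun t ht => ?_) (fun t ht => ?_) ⟨2, by simp, ?_⟩
        · exact lt_of_lt_of_le one_pos ht.1
        · exact (hmono (show (0 : ℝ) < 1 from one_pos) (show (0 : ℝ) < t by linarith [ht.1])
            ht.1).le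
        · exact hmono (show (0 : ℝ) < 1 from one_pos) (show (0 : ℝ) < 2 by norm_num) one_lt_two
      rw [intervalIntegral.integral_const, smul_eq_mul] at hI
      norm_num at hI
      have hlt : rLadder b x₀ 2 1 < 0 := by
        rw [show (2 : ℕ) = 1 + 1 from rfl, rLadder_succ_one]
        nlinarith
      exact exists_zero_of_neg_of_eventually_pos hcont2 one_pos hlt hpos2
    · push Not at hv
      have hZ1 : ∃ z, 1 < z ∧ rLadder b x₀ 1 z = 0 :=
        exists_zero_of_neg_of_eventually_pos hcont1 one_pos hv hpos1
      refine exists_zero_gt_of_adjoint_step (k := x₀ + (0 + 1 : ℕ)) (b := b) (c := 1)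
        (by push_cast; linarith) (by linarith) ?_
        (fun s hs => hasDerivAt_rLadder_succ b hx (0 + 1) hs)
        (fun s hs => hasDerivAt_mul_rLadder b hx 2 hs)
        hcont1 (finite_zeros_rLadder b hx0 hx 1) zero_le_one hZ1 hpos1 hpos2
      push_cast; linarith

/-- **Every rung from the second one on vanishes somewhere beyond `s = 1`** (`b > 1`,
`0 ≤ x₀ < 1`): induction along the ladder by Greaves's step. [folklore] -/
theorem exists_one_lt_zero_rLadder (b : ℝ) {x₀ : ℝ} (hx0 : 0 ≤ x₀) (hx : x₀ < 1) (hb : 1 < b) :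
    ∀ m : ℕ, ∃ z, 1 < z ∧ rLadder b x₀ (m + 2) z = 0
  | 0 => exists_one_lt_zero_rLadder_two b hx0 hx hb
  | m + 1 => by
    have ih := exists_one_lt_zero_rLadder b hx0 hx hb m
    refine exists_zero_gt_of_adjoint_step (k := x₀ + (m + 2 : ℕ)) (b := b) (c := 1)
      (by positivity) (by linarith) ?_
      (fun s hs => hasDerivAt_rLadder_succ b hx (m + 2) hs)
      (fun s hs => hasDerivAt_mul_rLadder b hx (m + 1 + 2) hs)
      (continuousOn_rLadder b hx (m + 2)) (finite_zeros_rLadder b hx0 hx (m + 2)) zero_le_one ih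
      (eventually_rLadder_pos b hx0 hx (m + 2)) (eventually_rLadder_pos b hx0 hx (m + 1 + 2))
    push_cast; linarith

/-- `⌊2κ⌋ ≥ 2` for `κ ≥ 1`. [folklore] -/
theorem two_le_floor_two_mul (hκ : 1 ≤ κ) : 2 ≤ ⌊2 * κ⌋₊ :=
  Nat.le_floor (by push_cast; linarith)

/-- **For `κ > 1`, Iwaniec's adjoint `q_κ` has a zero exceeding `1`** (hence its greatest zero
`β_κ − 1` exceeds `1`, `two_lt_iwaniecSiftingLimit`). Not stated in the sources; it follows from
Greaves's induction step (proof of Lemma 4.2.3 (ii)) started at the second rung of the ladder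
(`exists_one_lt_zero_rLadder`). [folklore] -/
theorem exists_one_lt_zero_qFun (hκ : 1 < κ) : ∃ z, 1 < z ∧ qFun κ z = 0 := by
  have key : ∀ n : ℕ, 2 ≤ n → ∃ z, 1 < z ∧ rLadder κ (2 * κ - ⌊2 * κ⌋₊) n z = 0 := by
    intro n hn
    obtain ⟨m, rfl⟩ : ∃ m, n = m + 2 := ⟨n - 2, by omega⟩
    exact exists_one_lt_zero_rLadder κ (two_mul_sub_floor_nonneg (by linarith))
      (two_mul_sub_floor_lt_one κ) hκ m
  exact key _ (two_le_floor_two_mul hκ.le)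

/-! ### The sign of `q_κ` near `0⁺` for `κ > 1` -/

/-- **Sign near `0⁺` from the sign at `1`** (`κ > 1`): if `g` is continuous on `(0, ∞)`, solves
`(s g(s))' = κ g(s) + κ g(s + 1)` there, and `g(1) > 0`, then `g` takes a negative value in
`(0, 1)`. Indeed `G(s) = s^{1−κ} g(s)` has `G'(s) = κ s^{−κ} g(s + 1) ≥ κ m s^{−κ}` near `0⁺`
(`m = g(1)/2`), and `∫_0 s^{−κ} ds = ∞` for `κ > 1`, so `G(s) → −∞` as `s → 0⁺`. [folklore] -/
theorem exists_neg_of_adjoint_of_pos {g : ℝ → ℝ} (hκ : 1 < κ)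
    (hadj : ∀ s, 0 < s → HasDerivAt (fun t => t * g t) (κ * g s + κ * g (s + 1)) s)
    (hg : ContinuousOn g (Ioi 0)) (h1 : 0 < g 1) : ∃ s, 0 < s ∧ s < 1 ∧ g s < 0 := by
  set m : ℝ := g 1 / 2 with hm
  have hm0 : 0 < m := by positivity
  -- `g ≥ m` on `[1, 1 + δ]`
  have hcont1 : ContinuousAt g 1 := hg.continuousAt (Ioi_mem_nhds one_pos)
  have hev : ∀ᶠ x in 𝓝 (1 : ℝ), m < g x := hcont1.eventually_const_lt (by rw [hm]; linarith)
  obtain ⟨ε, hε, hεg⟩ := Metric.eventually_nhds_iff.mp hev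
  set δ : ℝ := min (ε / 2) 1 with hδ
  have hδ0 : 0 < δ := lt_min (by linarith) one_pos
  have hδ1 : δ ≤ 1 := min_le_right _ _
  have hδε : δ < ε := lt_of_le_of_lt (min_le_left _ _) (by linarith)
  have hgm : ∀ x, 0 < x → x ≤ δ → m < g (x + 1) := by
    intro x hx hxδ
    refine hεg ?_
    rw [Real.dist_eq, show x + 1 - 1 = x by ring, abs_of_pos hx]
    linarith
  -- the comparison function `Φ(s) = s^{-κ} (s g(s)) + C s^{1-κ}`, `C = κ m/(κ-1)`
  set C : ℝ := κ * m / (κ - 1) with hC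
  have hκ1 : 0 < κ - 1 := by linarith
  have hκ0 : 0 < κ := by linarith
  have hC0 : 0 < C := by positivity
  set Φ : ℝ → ℝ := fun s => s ^ (-κ) * (s * g s) + C * s ^ (1 - κ) with hΦ
  have hΦd : ∀ s, 0 < s → HasDerivAt Φ (κ * s ^ (-κ) * (g (s + 1) - m)) s := by
    intro s hs
    have h1 : HasDerivAt (fun t => t ^ (-κ) * (t * g t))
        (-κ * s ^ (-κ - 1) * (s * g s) + s ^ (-κ) * (κ * g s + κ * g (s + 1))) s :=
      (Real.hasDerivAt_rpow_const (Or.inl hs.ne')).mul (hadj s hs)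
    have h2 : HasDerivAt (fun t => C * t ^ (1 - κ)) (C * ((1 - κ) * s ^ (1 - κ - 1))) s :=
      (Real.hasDerivAt_rpow_const (Or.inl hs.ne')).const_mul C
    refine (h1.add h2).congr_deriv ?_
    have e1 : s ^ (-κ - 1) * s = s ^ (-κ) := by
      rw [← Real.rpow_add_one hs.ne', show -κ - 1 + 1 = -κ by ring]
    have e2 : s ^ (1 - κ - 1) = s ^ (-κ) := by rw [show (1 : ℝ) - κ - 1 = -κ by ring]
    have e3 : C * (1 - κ) = -(κ * m) := by
      rw [hC]; field_simp; ring
    calc -κ * s ^ (-κ - 1) * (s * g s) + s ^ (-κ) * (κ * g s + κ * g (s + 1)) + C * ((1 - κ) * s ^ (1 - κ - 1))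
        = -κ * (s ^ (-κ - 1) * s) * g s + s ^ (-κ) * (κ * g s + κ * g (s + 1))
            + C * (1 - κ) * s ^ (1 - κ - 1) := by ring
      _ = κ * s ^ (-κ) * (g (s + 1) - m) := by rw [e1, e2, e3]; ring
  -- `Φ` is monotone on `(0, δ]`
  have hΦmono : MonotoneOn Φ (Ioc 0 δ) := by
    have hconv : Convex ℝ (Ioc (0 : ℝ) δ) := convex_Ioc 0 δ
    refine monotoneOn_of_deriv_nonneg hconv ?_ ?_ ?_
    · exact continuousOn_of_forall_continuousAt fun x hx => (hΦd x hx.1).continuousAt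
    · intro x hx
      rw [interior_Ioc] at hx
      exact (hΦd x hx.1).differentiableAt.differentiableWithinAt
    · intro x hx
      rw [interior_Ioc] at hx
      rw [(hΦd x hx.1).deriv]
      have : m < g (x + 1) := hgm x hx.1 hx.2.le
      have hxpos : 0 < x := hx.1
      have hx0 : 0 ≤ κ * x ^ (-κ) := by positivity
      nlinarith
  -- choose `s` small: `s = t⁻¹` with `t^{κ-1} > Φ δ / C` and `t > 2/δ`
  obtain ⟨t, ht1, ht2⟩ := (((tendsto_rpow_atTop hκ1).eventually_gt_atTop (Φ δ / C)).and
    (eventually_gt_atTop (max 1 (2 / δ)))).exists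
  have ht1' : 1 < t := lt_of_le_of_lt (le_max_left _ _) ht2
  have ht0 : 0 < t := one_pos.trans ht1'
  set s : ℝ := t⁻¹ with hs
  have hs0 : 0 < s := inv_pos.mpr ht0
  have hsδ : s < δ := by
    rw [hs]
    have h2δ : 2 / δ < t := lt_of_le_of_lt (le_max_right _ _) ht2
    rw [inv_lt_comm₀ ht0 hδ0]
    calc δ⁻¹ = 1 / δ := (one_div δ).symm
      _ < 2 / δ := by apply div_lt_div_of_pos_right (by norm_num) hδ0
      _ < t := h2δ
  have hs1 : s < 1 := by rw [hs]; exact inv_lt_one_of_one_lt₀ ht1'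
  have hpow : s ^ (1 - κ) = t ^ (κ - 1) := by
    rw [hs, Real.inv_rpow ht0.le, ← Real.rpow_neg ht0.le, show -(1 - κ) = κ - 1 by ring]
  -- `Φ s ≤ Φ δ`, hence `s^{-κ} (s g s) ≤ Φ δ - C s^{1-κ} < 0`
  have hle : Φ s ≤ Φ δ := hΦmono ⟨hs0, hsδ.le⟩ ⟨hδ0, le_rfl⟩ hsδ.le
  have hCst : Φ δ < C * s ^ (1 - κ) := by
    rw [hpow]
    have := (div_lt_iff₀ hC0).mp ht1
    linarith
  have hG : s ^ (-κ) * (s * g s) < 0 := by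
    have : Φ s = s ^ (-κ) * (s * g s) + C * s ^ (1 - κ) := rfl
    linarith
  refine ⟨s, hs0, hs1, ?_⟩
  by_contra hge
  push Not at hge
  have : 0 ≤ s ^ (-κ) * (s * g s) := by positivity
  linarith

/-- For `κ > 1`: `q_κ(1) > 0` forces `q_κ < 0` somewhere in `(0, 1)`. [folklore] -/
theorem exists_qFun_neg_of_pos (hκ : 1 < κ) (h1 : 0 < qFun κ 1) :
    ∃ s, 0 < s ∧ s < 1 ∧ qFun κ s < 0 :=
  exists_neg_of_adjoint_of_pos hκ (fun _ hs => hasDerivAt_mul_qFun κ hs) (continuousOn_qFun κ) h1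

/-- For `κ > 1`: `q_κ(1) < 0` forces `q_κ > 0` somewhere in `(0, 1)` (the previous lemma for
`−q_κ`, the adjoint equation being linear). [folklore] -/
theorem exists_qFun_pos_of_neg (hκ : 1 < κ) (h1 : qFun κ 1 < 0) :
    ∃ s, 0 < s ∧ s < 1 ∧ 0 < qFun κ s := by
  have hadj : ∀ s, 0 < s →
      HasDerivAt (fun t => t * (-qFun κ t)) (κ * (-qFun κ s) + κ * (-qFun κ (s + 1))) s := by
    intro s hs
    have h := (hasDerivAt_mul_qFun κ hs).neg
    have h' : HasDerivAt (fun t => t * (-qFun κ t)) (-(κ * qFun κ s + κ * qFun κ (s + 1))) s :=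
      h.congr_of_eventuallyEq (Eventually.of_forall fun t => by simp only [Pi.neg_apply, mul_neg])
    exact h'.congr_deriv (by ring)
  obtain ⟨s, hs, hs1, hlt⟩ :=
    exists_neg_of_adjoint_of_pos hκ hadj (continuousOn_qFun κ).neg (by linarith)
  exact ⟨s, hs, hs1, by linarith⟩

/-- **For `κ > 1`, `q_κ` has at least two positive zeros.** By trichotomy on `q_κ(1)`: if
`q_κ(1) < 0`, `q_κ` is positive near `0⁺` (`exists_qFun_pos_of_neg`) and eventually positive, so
it vanishes in `(0, 1)` and in `(1, ∞)`; if `q_κ(1) = 0`, the second zero is the one beyond `1`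
(`exists_one_lt_zero_qFun`); if `q_κ(1) > 0`, `q_κ` is negative near `0⁺` and vanishes in
`(0, 1)`, besides the zero beyond `1`. (Greaves, Lemma 4.2.3 (i): fewer than `2κ` zeros; for
`1/2 < κ < 1` exactly one, `BetaSieveSmallDimension.qFun_zero_unique`; for `κ = 3/2`, `2` the two
resp. three zeros of the printed polynomials.) Not stated in the sources. [folklore] -/
theorem exists_two_zeros_qFun (hκ : 1 < κ) :
    ∃ z₁ z₂, 0 < z₁ ∧ z₁ < z₂ ∧ qFun κ z₁ = 0 ∧ qFun κ z₂ = 0 := by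
  obtain ⟨z, hz1, hz0⟩ := exists_one_lt_zero_qFun hκ
  have hcont : ∀ s, 0 < s → ContinuousOn (qFun κ) (Icc s 1) := fun s hs =>
    (continuousOn_qFun κ).mono fun x hx => lt_of_lt_of_le hs hx.1
  rcases lt_trichotomy (qFun κ 1) 0 with h1 | h1 | h1
  · obtain ⟨s, hs, hs1, hpos⟩ := exists_qFun_pos_of_neg hκ h1
    obtain ⟨z₁, hz₁mem, hz₁⟩ := intermediate_value_Icc' hs1.le (hcont s hs) ⟨h1.le, hpos.le⟩
    exact ⟨z₁, z, hs.trans_le hz₁mem.1, lt_of_le_of_lt hz₁mem.2 hz1, hz₁, hz0⟩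
  · exact ⟨1, z, one_pos, hz1, h1, hz0⟩
  · obtain ⟨s, hs, hs1, hneg⟩ := exists_qFun_neg_of_pos hκ h1
    obtain ⟨z₁, hz₁mem, hz₁⟩ := intermediate_value_Icc hs1.le (hcont s hs) ⟨hneg.le, h1.le⟩
    exact ⟨z₁, z, hs.trans_le hz₁mem.1, lt_of_le_of_lt hz₁mem.2 hz1, hz₁, hz0⟩

end SieveAdjoint

/-! ### Consequences for the two pins of the `β`-sieve data -/

section Pins

variable {κ : ℝ}

/-- Every positive zero `z` of `q_κ` (`κ > 1/2`) bounds the least admissible `β` from above: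
`siftingLimit κ ≤ 1 + z` (sufficiency at every zero, `exists_isBetaSieveSolution_of_qFun_eq_zero`,
and minimality of `IsBetaSieveData`). [folklore] -/
theorem siftingLimit_le_one_add (hκ : 1 / 2 < κ) {z : ℝ} (hz : 0 < z) (h0 : qFun κ z = 0) :
    siftingLimit κ ≤ 1 + z := by
  have h := isBetaSieveData_betaSieveData' (κ := κ) hκ.le
  obtain ⟨F, f, A, hS⟩ := exists_isBetaSieveSolution_of_qFun_eq_zero hκ hz h0
  exact h.2 F f _ A hS

/-- Every positive zero `z` of `q_κ` (`κ > 1/2`) bounds Iwaniec's `β_κ` from below: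
`1 + z ≤ iwaniecSiftingLimit κ` (sufficiency at every zero and maximality of
`IsGreatestBetaSieveData`). [folklore] -/
theorem one_add_le_iwaniecSiftingLimit (hκ : 1 / 2 < κ) {z : ℝ} (hz : 0 < z) (h0 : qFun κ z = 0) :
    1 + z ≤ iwaniecSiftingLimit κ := by
  have h := isGreatestBetaSieveData_greatestBetaSieveData' (κ := κ) hκ.le
  obtain ⟨F, f, A, hS⟩ := exists_isBetaSieveSolution_of_qFun_eq_zero hκ hz h0
  exact h.2 F f _ A hS

/-- **`siftingLimit κ − 1` is the LEAST positive zero of `q_κ`** (`κ > 1/2`): the tree's least-`β`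
pin, made explicit (necessity `IsBetaSieveSolution.qFun_beta_sub_one_eq_zero'`, `β > 1` by
`IsBetaSieveSolution.one_lt_of_half_lt`, and `siftingLimit_le_one_add`). [folklore] -/
theorem isLeast_siftingLimit_sub_one (hκ : 1 / 2 < κ) :
    IsLeast {z | 0 < z ∧ qFun κ z = 0} (siftingLimit κ - 1) := by
  have hS := isBetaSieveSolution_upperSieveFun_lowerSieveFun exists_isBetaSieveData_holds hκ.le
  refine ⟨⟨by linarith [hS.one_lt_of_half_lt hκ], hS.qFun_beta_sub_one_eq_zero' hκ⟩, ?_⟩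
  rintro z ⟨hz, h0⟩
  linarith [siftingLimit_le_one_add hκ hz h0]

/-- **`iwaniecSiftingLimit κ − 1` is the GREATEST positive zero of `q_κ`** (`κ > 1/2`) — Iwaniec's
definition of `β_κ` (Iwaniec 1980, §7, p. 193; Greaves (4.2.4.10): "`β − 1` is the largest real
zero of `q`"), recovered for the greatest-`β` pin `IsGreatestBetaSieveData`.
[cite: Greaves2001, (4.2.4.10)] -/
theorem isGreatest_iwaniecSiftingLimit_sub_one (hκ : 1 / 2 < κ) :
    IsGreatest {z | 0 < z ∧ qFun κ z = 0} (iwaniecSiftingLimit κ - 1) := by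
  have hS := isBetaSieveSolution_iwaniecUpperSieveFun_iwaniecLowerSieveFun
    exists_isGreatestBetaSieveData_holds hκ.le
  refine ⟨⟨by linarith [hS.one_lt_of_half_lt hκ], hS.qFun_beta_sub_one_eq_zero' hκ⟩, ?_⟩
  rintro z ⟨hz, h0⟩
  linarith [one_add_le_iwaniecSiftingLimit hκ hz h0]

/-- **`β_κ > 2` for `κ > 1`**: Iwaniec's sifting limit exceeds `2` in every dimension `κ > 1`
(`β_1 = 2`, `LinearSieveExistence.iwaniecSiftingLimit_one`; `β_{3/2} = 3.366…`, `β_2 = 4.834…`,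
Diamond–Halberstam–Galway, Table 15.3). From `SieveAdjoint.exists_one_lt_zero_qFun`; not stated in
the sources in this form. [folklore] -/
theorem two_lt_iwaniecSiftingLimit (hκ : 1 < κ) : 2 < iwaniecSiftingLimit κ := by
  obtain ⟨z, hz1, hz0⟩ := SieveAdjoint.exists_one_lt_zero_qFun hκ
  have := one_add_le_iwaniecSiftingLimit (by linarith) (by linarith) hz0
  linarith

/-- **The least-`β` pin is never Iwaniec's for `κ > 1`: `siftingLimit κ < iwaniecSiftingLimit κ`.**
`q_κ` has two positive zeros `z₁ < z₂` (`SieveAdjoint.exists_two_zeros_qFun`), the normalised system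
is solvable at both (`exists_isBetaSieveSolution_of_qFun_eq_zero`), so the least admissible `β` is
`≤ 1 + z₁ < 1 + z₂ ≤` the greatest. This is the blanket form of the erratum of
`SieveFunctions.lean` (there proved for `κ = 3/2`, `SieveFunctionsProofs.siftingLimit_three_halves_lt`,
and `κ = 2`, `JurkatRichertRefutation.lean`); for `1/2 ≤ κ ≤ 1` the pins coincide
(`BetaSieveSmallDimension.siftingLimit_eq_iwaniecSiftingLimit`). [folklore] -/
theorem siftingLimit_lt_iwaniecSiftingLimit (hκ : 1 < κ) :
    siftingLimit κ < iwaniecSiftingLimit κ := by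
  obtain ⟨z₁, z₂, hz₁, hlt, h₁, h₂⟩ := SieveAdjoint.exists_two_zeros_qFun hκ
  have a := siftingLimit_le_one_add (by linarith) hz₁ h₁
  have b := one_add_le_iwaniecSiftingLimit (by linarith) (hz₁.trans hlt) h₂
  linarith

/-- **Exactly where the two pins agree**: for `κ ≥ 1/2`,
`siftingLimit κ = iwaniecSiftingLimit κ ↔ κ ≤ 1`. [folklore] -/
theorem siftingLimit_eq_iwaniecSiftingLimit_iff (hκ : 1 / 2 ≤ κ) :
    siftingLimit κ = iwaniecSiftingLimit κ ↔ κ ≤ 1 := by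
  constructor
  · intro h
    by_contra h1
    push Not at h1
    exact (siftingLimit_lt_iwaniecSiftingLimit h1).ne h
  · exact siftingLimit_eq_iwaniecSiftingLimit hκ

/-- The two `Classical.epsilon`-chosen data differ for `κ > 1` (their `β`-components differ).
[folklore] -/
theorem betaSieveData_ne_greatestBetaSieveData (hκ : 1 < κ) :
    betaSieveData κ ≠ greatestBetaSieveData κ := by
  intro h
  have := siftingLimit_lt_iwaniecSiftingLimit hκ
  simp only [siftingLimit, iwaniecSiftingLimit, h, lt_self_iff_false] at this

/-- The two pinning PREDICATES differ for `κ > 1`. [folklore] -/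
theorem isBetaSieveData_ne_isGreatestBetaSieveData (hκ : 1 < κ) :
    IsBetaSieveData κ ≠ IsGreatestBetaSieveData κ := by
  intro h
  have h1 := isBetaSieveData_betaSieveData' (κ := κ) (by linarith)
  rw [h] at h1
  have h2 := isGreatestBetaSieveData_greatestBetaSieveData' (κ := κ) (by linarith)
  have h3 : siftingLimit κ = iwaniecSiftingLimit κ := h1.beta_eq h2
  exact (siftingLimit_lt_iwaniecSiftingLimit hκ).ne h3

/-- **`A`-constants: `betaSieveConst κ < iwaniecSieveConst κ` for `κ > 1`.** Both are
`2 (β − 1)^{κ−1} / p_κ(β − 1)` at the respective `β` (Greaves, Lemma 4.2.5;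
`IsBetaSieveSolution.const_eq_rosserAdjointP`), and `β ↦ (β − 1)^{κ−1}/p_κ(β − 1)` is strictly
increasing for `κ > 1` (`p_κ > 0` is antitone). [folklore] -/
theorem betaSieveConst_lt_iwaniecSieveConst (hκ : 1 < κ) :
    betaSieveConst κ < iwaniecSieveConst κ := by
  have hκ0 : 0 ≤ κ := by linarith
  have hβ := siftingLimit_lt_iwaniecSiftingLimit hκ
  have hβ1 : 1 < siftingLimit κ := one_lt_siftingLimit (by linarith)
  have hβ2 : 1 < iwaniecSiftingLimit κ := by linarith
  have hS := isBetaSieveSolution_upperSieveFun_lowerSieveFun exists_isBetaSieveData_holds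
    (show (1 : ℝ) / 2 ≤ κ by linarith)
  have hS' := isBetaSieveSolution_iwaniecUpperSieveFun_iwaniecLowerSieveFun
    exists_isGreatestBetaSieveData_holds (show (1 : ℝ) / 2 ≤ κ by linarith)
  rw [hS.const_eq_rosserAdjointP hκ0 hβ1, hS'.const_eq_rosserAdjointP hκ0 hβ2]
  have hp1 : 0 < rosserAdjointP κ (siftingLimit κ - 1) := rosserAdjointP.pos hκ0 (by linarith)
  have hp2 : 0 < rosserAdjointP κ (iwaniecSiftingLimit κ - 1) := rosserAdjointP.pos hκ0 (by linarith)
  have hpp : rosserAdjointP κ (iwaniecSiftingLimit κ - 1) ≤ rosserAdjointP κ (siftingLimit κ - 1) :=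
    rosserAdjointP.antitoneOn hκ0 (show (0 : ℝ) < siftingLimit κ - 1 by linarith)
      (show (0 : ℝ) < iwaniecSiftingLimit κ - 1 by linarith) (by linarith)
  have hpow : (siftingLimit κ - 1) ^ (κ - 1) < (iwaniecSiftingLimit κ - 1) ^ (κ - 1) :=
    Real.rpow_lt_rpow (by linarith) (by linarith) (by linarith)
  have hpow0 : 0 < (siftingLimit κ - 1) ^ (κ - 1) := Real.rpow_pos_of_pos (by linarith) _
  rw [div_lt_div_iff₀ hp1 hp2]
  calc 2 * (siftingLimit κ - 1) ^ (κ - 1) * rosserAdjointP κ (iwaniecSiftingLimit κ - 1)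
      ≤ 2 * (siftingLimit κ - 1) ^ (κ - 1) * rosserAdjointP κ (siftingLimit κ - 1) :=
        mul_le_mul_of_nonneg_left hpp (by positivity)
    _ < 2 * (iwaniecSiftingLimit κ - 1) ^ (κ - 1) * rosserAdjointP κ (siftingLimit κ - 1) := by
        have := mul_lt_mul_of_pos_right hpow hp1
        nlinarith

/-- **`upperSieveFun κ 1 < iwaniecUpperSieveFun κ 1` for `κ > 1`**: at `s = 1` both functions equal
their `A`-constant (`F(s) = A s^{−κ}` on `(0, β + 1]`). In particular the least-`β` function
`upperSieveFun κ` of `SieveSequence.jurkat_richert_upper` is NOT Iwaniec's `F_κ` for any `κ > 1`.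
[folklore] -/
theorem upperSieveFun_one_lt_iwaniecUpperSieveFun_one (hκ : 1 < κ) :
    upperSieveFun κ 1 < iwaniecUpperSieveFun κ 1 := by
  have hS := isBetaSieveSolution_upperSieveFun_lowerSieveFun exists_isBetaSieveData_holds
    (show (1 : ℝ) / 2 ≤ κ by linarith)
  have hS' := isBetaSieveSolution_iwaniecUpperSieveFun_iwaniecLowerSieveFun
    exists_isGreatestBetaSieveData_holds (show (1 : ℝ) / 2 ≤ κ by linarith)
  rw [hS.upper_eq 1 ⟨one_pos, by linarith [hS.one_le]⟩,
    hS'.upper_eq 1 ⟨one_pos, by linarith [hS'.one_le]⟩, Real.one_rpow, mul_one, mul_one]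
  exact betaSieveConst_lt_iwaniecSieveConst hκ

/-- `upperSieveFun κ ≠ iwaniecUpperSieveFun κ` for `κ > 1`. [folklore] -/
theorem upperSieveFun_ne_iwaniecUpperSieveFun (hκ : 1 < κ) :
    upperSieveFun κ ≠ iwaniecUpperSieveFun κ := fun h =>
  (upperSieveFun_one_lt_iwaniecUpperSieveFun_one hκ).ne (by rw [h])

/-- **The lower function of a normalised solution is positive just above `β`**: for
`β < s < β + 1`, `s^κ f(s) = ∫_β^s κ t^{κ−1} F(t − 1) dt > 0`, since `F(t − 1) = A (t − 1)^{−κ} > 0`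
for `1 ≤ β < t < β + 1` (`κ > 0`). [folklore] -/
theorem IsBetaSieveSolution.lower_pos {F f : ℝ → ℝ} {β A : ℝ} (h : IsBetaSieveSolution κ F f β A)
    (hκ : 0 < κ) {s : ℝ} (hβs : β < s) (hs : s < β + 1) : 0 < f s := by
  have hβ1 := h.one_le
  have hs0 : 0 < s := by linarith
  set Ψ : ℝ → ℝ := fun t => t ^ κ * f t with hΨ
  have hFpos : ∀ t, β < t → t < β + 1 → 0 < F (t - 1) := by
    intro t ht ht'
    rw [h.upper_eq (t - 1) ⟨by linarith, by linarith⟩]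
    exact mul_pos h.pos (Real.rpow_pos_of_pos (by linarith) _)
  have hcontΨ : ContinuousOn Ψ (Icc β s) := by
    refine ContinuousOn.mul (fun t ht => ?_) (h.continuousOn_lower.mono fun t ht => ?_)
    · exact (Real.continuousAt_rpow_const _ _
        (Or.inl (by linarith [ht.1] : t ≠ 0))).continuousWithinAt
    · exact lt_of_lt_of_le (by linarith) ht.1
  have hΨβ : Ψ β = 0 := by
    simp only [hΨ, h.lower_eq β ⟨by linarith, le_rfl⟩, mul_zero]
  have hmono : StrictMonoOn Ψ (Icc β s) := by
    refine strictMonoOn_of_deriv_pos (convex_Icc β s) hcontΨ fun t ht => ?_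
    rw [interior_Icc] at ht
    rw [(h.hasDerivAt_lower t ht.1).deriv]
    exact mul_pos (mul_pos hκ (Real.rpow_pos_of_pos (by linarith [ht.1]) _))
      (hFpos t ht.1 (by linarith [ht.2]))
  have hΨs : 0 < Ψ s := by
    rw [← hΨβ]
    exact hmono ⟨le_rfl, hβs.le⟩ ⟨hβs.le, le_rfl⟩ hβs
  have hsk : 0 < s ^ κ := Real.rpow_pos_of_pos hs0 _
  by_contra hle
  push Not at hle
  have : Ψ s ≤ 0 := mul_nonpos_of_nonneg_of_nonpos hsk.le hle
  linarith

/-- **`lowerSieveFun κ ≠ iwaniecLowerSieveFun κ` for `κ > 1`**: just above the least admissible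
`β` the least-`β` lower function is already positive (`IsBetaSieveSolution.lower_pos`), whereas
Iwaniec's `f_κ` still vanishes there (`f_κ = 0` on `(0, β_κ]`, `β_κ > siftingLimit κ`). [folklore] -/
theorem lowerSieveFun_ne_iwaniecLowerSieveFun (hκ : 1 < κ) :
    lowerSieveFun κ ≠ iwaniecLowerSieveFun κ := by
  have hS := isBetaSieveSolution_upperSieveFun_lowerSieveFun exists_isBetaSieveData_holds
    (show (1 : ℝ) / 2 ≤ κ by linarith)
  have hS' := isBetaSieveSolution_iwaniecUpperSieveFun_iwaniecLowerSieveFun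
    exists_isGreatestBetaSieveData_holds (show (1 : ℝ) / 2 ≤ κ by linarith)
  have hβ := siftingLimit_lt_iwaniecSiftingLimit hκ
  have hβ1 : 1 < siftingLimit κ := one_lt_siftingLimit (by linarith)
  -- a point in `(siftingLimit κ, min (siftingLimit κ + 1) (iwaniecSiftingLimit κ))`
  set s : ℝ := min (siftingLimit κ + 1) (iwaniecSiftingLimit κ) with hs
  set u : ℝ := (siftingLimit κ + s) / 2 with hu
  have hsu1 : siftingLimit κ < u := by
    have : siftingLimit κ < s := lt_min (by linarith) hβ
    rw [hu]; linarith
  have hu2 : u < siftingLimit κ + 1 := by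
    have : s ≤ siftingLimit κ + 1 := min_le_left _ _
    have : siftingLimit κ < s := lt_min (by linarith) hβ
    rw [hu]; linarith
  have hu3 : u ≤ iwaniecSiftingLimit κ := by
    have : s ≤ iwaniecSiftingLimit κ := min_le_right _ _
    have : siftingLimit κ < s := lt_min (by linarith) hβ
    rw [hu]; linarith
  intro h
  have h1 : 0 < lowerSieveFun κ u := hS.lower_pos (by linarith) hsu1 hu2
  have h2 : iwaniecLowerSieveFun κ u = 0 := hS'.lower_eq u ⟨by linarith, hu3⟩
  rw [h, h2] at h1
  exact lt_irrefl _ h1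

end Pins

end Literature.NumberTheory.Sieve
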